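import Summits.BirchSwinnertonDyer.Rank1Residual.Additive.TameBranchExtraZerosRankOne
import HarnessLib

/-!
# THE EXTRA ZEROS' CONTRIBUTION on defect 3, 4, 6 at rank one — FROM PRINT, TWO VALUES AND ONE RIEMANN
# SUM: the exact linear coefficient `‖[T¹]B‖ = ‖RS 1 n₁‖`, `1 ≤ λ(X) ≤ λ_an`, and
# `ord Ш[p^∞] + ord Reg_p + ord ∏c + ord ℓ ≤ μ(X) + ord_p RS(1,n₁) + c + 1 + 2 ord #tors`, `=` iff
# `λ(X) = λ_an` (cell `b2b-bsdres`, sub-cell additive-p2 = X3♯(G-ord)/X4♯(G-ord), gen 29; part 3 of 3)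

HONEST FRAMING (cell `b2b-bsdres`, run/shared/lean/b2b/bsd-rank1-residual/, verbatim in every
file): the goal of the cell is to DELETE the COMBINATION-SHAPED residual classes of the
Birch–Swinnerton-Dyer formula for ALL analytic-rank `≤ 1` elliptic curves over `ℚ` — "full BSD
formula for every rank `≤ 1` curve in class `C`" assembled STRICTLY from published theorems — so
that the rank-`≤ 1` remainder becomes exactly the CONSTRUCTION-SHAPED classes, which are TYPED
(missing-input `Prop`s), NOT attempted. This is not "finishing BSD". Sub-cell additive-p2: the
classes X3♯(G-ord) / X4♯(G-ord) are CONSTRUCTION-SHAPED and stay so; labels / RESIDUAL-MAP marks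
UNCHANGED; nothing is booked. Theorems only; the named facts enter as hypothesis binders
(`Delbourgo1998.thm1_exists_bounded_evenMeasure` A282, `Delbourgo2002.mainTheorem` A175,
`Delbourgo2002.thmC_charIdeal_dvd_tameBranch` A227, `Delbourgo2002.mainTheorem_potMult`, GZK).
No definition, no `sorry`.

## What and why

Gen 28 (`TameBranchTwoValueSimpleZero`) reached Schneider on the `λ_an ≥ 2` rank-one rows of
X3♯(G-ord)/X4♯(G-ord) ∩ {e ∈ {3,4,6}} from PRINT + TWO values (the sign, type-free) + ONE Riemann sum
`RS(1,n₁)` of the forced partner beating the truncation error (`[T¹]B ≠ 0`), and recorded the leading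
term identity as NOT claimed there. This part closes that: the SAME inputs give

* the EXACT linear coefficient, `‖[T¹]B‖ = ‖RS 1 n₁‖` (ultrametric: `‖[T¹]B − RS 1 n₁‖ ≤ p^c·p^{−n₁} <
  ‖RS 1 n₁‖`; §4 `valuation_eq_of_norm_sub_lt`) — the census's E-FORCED-7 column `v_p RS(1,n)` IS
  `ord_p[T¹]B` once `v_p RS(1,n) < n − c`;
* the FIRST TOP of the same branch at `k` (the two values, on either line `t ∈ {1, e−1}`: gen 27's
  unstarred certificate or gen 28's inverse form);
* hence, by part 2, for every (B)-datum: Schneider, `#Ш[p^∞] < ∞`, and for every cyclotomic dual datum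
  with generator `fE`: **`1 ≤ λ(fE) ≤ k`** and
  **`ord_p #Ш[p^∞] + ord_p Reg_p + ord_p ∏c + ord_p ℓ ≤ μ(fE) + ord_p RS(1,n₁) + c + 1 + 2 ord_p #tors`,
  EQUALITY iff `λ(fE) = k`** (§4
  `exists_schneider_and_padicVal_le_rankOne_of_thm1_of_two_norm_ratTwistedSymbolSum_of_riemannSum`;
  §5 `ClassX4Gord.…` with `c = 0` by Drinfeld–Manin, `ClassX3Gord.…` with the tower bound `p^c`).

READING. The per-pair residue of the tame-branch route at rank one is unchanged in SIZE (two values + one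
Riemann sum on `λ_an ≥ 2` rows, gen 28) but now DELIVERS the leading-term statement on every row:
on `λ_an = 1` rows the identity modulo `μ` (gens 20/27/28), on `λ_an ≥ 2` rows the inequality modulo `μ`
whose equality case is exactly the λ-part of the main conjecture `λ(X(E/ℚ_∞)) = λ_an`. EVIDENCE (not an
input; gen 23 `ENGINE-FORCED-PARTNER.md` §4, gen 24 `ENGINE-2.md` Table E, zero new compute): on the five
`λ_an ≥ 2` window rows the certified Riemann sums give `ord_p[T¹]B = 1, 1, 2, 1, 1` (175a1, 6650bi1,
19950dh1 @5; 10878bk1, 11760bb1 @7; `v_p RS(1,n₁) < n₁` at the tabulated level `n₁ = 3` (`4` for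
19950dh1), so the hypothesis `p^{−n₁} < ‖RS 1 n₁‖` is MET), and the census identity
`v_p([T¹]B·log_p γ) = v_p(h) + v_p(Ш_an∏c/#T²)` holds with NO extra constant (13/13) — i.e. under the
identifications `Ш ↔ Ш_an`, `Reg_p(Dh) ↔ h` (engine height), `ℓ = 1`, `μ = 0` the data sit in the
EQUALITY case: consistent with `λ(X) = λ_an ∈ {3, 5, 5, 3, 3}` (extra ALGEBRAIC zeros) at those pairs;
under the same identifications the theorem reads `BSD(E,p) ∧ μ(X) = 0 ⟹ λ(X) = λ_an` there (a strict
inequality would say `ord_p #Ш < ord_p #Ш_an`). Nothing booked; labels UNCHANGED.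

Not claimed: `μ`; the UPPER or LOWER half; engine height = Delbourgo's `⟨,⟩_{p,ℚ}`; any booking.
References: [Delbourgo1998] Thm. 1; [Delbourgo2002] Thm. (A)(B)(C); [SteinWuthrich2013] §3;
[MazurTateTeitelbaum1986Invent] §I.10–I.14; [Lang1990] Ch. 1 §2 Thm. 2.1; [Manin1972]; [Washington1997] §7.1. -/

set_option autoImplicit false

noncomputable section

open scoped Classical MatrixGroups ModularForm NumberField

open CongruenceSubgroup IsDedekindDomain WeierstrassCurve NumberField
  Literature.NumberTheory.EllipticCurves
  Literature.NumberTheory.EllipticCurves.ModularForms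
  Literature.NumberTheory.EllipticCurves.Rank1Residual
  Literature.NumberTheory.EllipticCurves.Rank1Residual.Typed
  Literature.NumberTheory.EllipticCurves.Delbourgo2002
  Summit.BirchSwinnertonDyer.Rank1Residual.X1.MuLambda
  Summit.BirchSwinnertonDyer.Rank1Residual.X1.RankOneParitySqueeze
  Summit.BirchSwinnertonDyer.Rank1Residual.X11a.LambdaNorm

namespace Summit.BirchSwinnertonDyer.Rank1Residual.Additive

/-! ### §4 Defect 3, 4, 6 at rank one: PRINT + two values + ONE Riemann sum — the exact linear
coefficient and the leading-term inequality with the extra zeros' contribution -/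

namespace TwistPartner

open TameBranchOneValue TameBranchTwoValue TameBranchExtraZeros

section Ultrametric

variable {p : ℕ} [hp : Fact p.Prime]

/-- **The exact value from one approximation (ultrametric).** `‖a − b‖ < ‖b‖ ⟹ a ≠ 0`, `‖a‖ = ‖b‖`
and `v_p(a) = v_p(b)` in `ℚ_p`. [folklore] -/
theorem valuation_eq_of_norm_sub_lt {a b : ℚ_[p]} (h : ‖a - b‖ < ‖b‖) :
    a ≠ 0 ∧ ‖a‖ = ‖b‖ ∧ a.valuation = b.valuation := by
  have hb : b ≠ 0 := by
    intro h0; rw [h0, norm_zero] at h; exact not_lt.mpr (norm_nonneg _) h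
  have hab : ‖a‖ = ‖b‖ := by
    have h1 := Padic.add_eq_max_of_ne h.ne
    rwa [sub_add_cancel, max_eq_right h.le] at h1
  have ha : a ≠ 0 := by
    intro h0; rw [h0, norm_zero] at hab; exact hb (norm_eq_zero.mp hab.symm)
  refine ⟨ha, hab, ?_⟩
  have h1p : (1 : ℝ) < p := by exact_mod_cast hp.out.one_lt
  rw [Padic.norm_eq_zpow_neg_valuation ha, Padic.norm_eq_zpow_neg_valuation hb] at hab
  have := zpow_right_injective₀ (zero_lt_one.trans h1p) h1p.ne' hab
  simpa using this

end Ultrametric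

section Join

variable {W : WeierstrassCurve ℚ} [W.IsElliptic] [W.IsGloballyMinimal] {p : ℕ} [hp : Fact p.Prime]
  {N : ℕ} [NeZero N] {f : CuspForm (Gamma0 N) 2} {χ : MulChar (ZMod p) ℚ_[p]} {ã : ℚ_[p]} {t : ℕ}
  {RS : ℕ → ℕ → ℚ_[p]}
  (hRS : ∀ k n : ℕ, RS k n =
      ∑ᶠ ξ : rootsOfUnity (Literature.NumberTheory.EllipticCurves.torsionOrder p) ℤ_[p],
        ∑ s : ZMod (p ^ n),
        twistPartnerMeasure (χ ^ t)
            (TwistPartner.forced (χ ^ t) (fun r ↦ ((ratPlusSymbol f r : ℚ) : ℚ_[p])) ã) ã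
            ((ratPlusSymbol f 0 : ℚ) : ℚ_[p]) (n + cyclotomicExponent p)
            (PadicInt.toZModPow (n + cyclotomicExponent p) ((ξ : ℤ_[p]ˣ) : ℤ_[p]) *
              (cyclotomicGenerator p : ZMod (p ^ (n + cyclotomicExponent p))) ^ s.val) *
          ((s.val.choose k : ℕ) : ℚ_[p]))

include hRS

/-- **`ord_{s=1}L(E,s) = 1`, ANY `λ_an = k`: SCHNEIDER, `1 ≤ λ(X) ≤ k` AND THE LEADING-TERM INEQUALITY
WITH THE EXTRA ZEROS' CONTRIBUTION — FROM PRINT, TWO VALUES AND ONE RIEMANN SUM.** `p ≥ 5`, ADDITIVE,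
(G)-ordinary, non-CM, `e ∈ {3,4,6}`; Delbourgo 1998 Thm 1, 2002 (A)(B)(C), GZK; a (G)-field `F`, `w ∣ p`,
THE unit root `ã`; `χ = ω^u` of order `e`; tower bound `p^c`; TWO even primitive `p`-power-order
characters at conductors `p^{n+1+e₀}`, `p^{n+2+e₀}` with their twisted symbol sums on ONE line
`t ∈ {1, e−1}` with a common `k`, `e·k < 2φₙ` (⟹ sign AND first top at `k`); ONE Riemann sum of the
forced partner of `(χ^t, ã)` at a level `n₁` with **`p^c·p^{−n₁} < ‖RS 1 n₁‖`**. Then a (B)-datum exists,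
and for EVERY (B)-datum `Dh`: Schneider, `#Ш[p^∞] < ∞`, and for every cyclotomic dual datum with
generator `fE`: `1 ≤ λ(fE) ≤ k` and
**`ord_p #Ш[p^∞] + ord_p Reg_p(E,Dh) + ord_p ∏c + ord_p ℓ ≤ μ(fE) + ord_p RS(1,n₁) + c + 1 + 2 ord_p #tors`,
EQUALITY iff `λ(fE) = k`** (`‖[T¹]B‖ = ‖RS 1 n₁‖` exactly: the truncation error is beaten). For `k = 1`
this is gen 28's identity modulo `μ`; for `k ≥ 2` the extra zeros' contribution `ord_p RS(1,n₁) + c ≥ 1`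
is READ, and the λ-part of the main conjecture at the pair is the equality. Nothing booked.
[cite: Delbourgo1998, Theorem 1 (p. 131)] [cite: Delbourgo2002, Theorem (A), (B), (C) (p. 40)]
[cite: SteinWuthrich2013, §3] [cite: MazurTateTeitelbaum1986Invent, §I.10–I.14] [cite: Washington1997, §7.1] -/
theorem exists_schneider_and_padicVal_le_rankOne_of_thm1_of_two_norm_ratTwistedSymbolSum_of_riemannSum
    (hD : Delbourgo1998.thm1_exists_bounded_evenMeasure)
    (hC : Delbourgo2002.thmC_charIdeal_dvd_tameBranch) (hDel : Delbourgo2002.mainTheorem)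
    (hDelM : Delbourgo2002.mainTheorem_potMult) (hGZK : rank_eq_analyticRank_of_analyticRank_le_one)
    (h5 : 5 ≤ p) (hcm : ¬ W.HasCM) (hadd : Addv W p) (hGord : TypeGOrd W p)
    (he : semistabilityIndex W p ∈ ({3, 4, 6} : Finset ℕ)) (hr : W.analyticRank = 1)
    (hf : IsNewformOf W f)
    {L : Type} [Field L] [NumberField L] [IsCyclotomicExtension {p} ℚ L] (F : IntermediateField ℚ L)
    (hF : ∀ w : HeightOneSpectrum (𝓞 F), (p : 𝓞 F) ∈ w.asIdeal →
      (W.baseChange F).HasGoodReductionAt w ∧ (W.baseChange F).HasUnitRootAt w)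
    (w : HeightOneSpectrum (𝓞 F)) (hw : (p : 𝓞 F) ∈ w.asIdeal)
    (hã : ‖ã‖ = 1) (hroot : ã ^ 2 - (((W.baseChange F).frobeniusTraceAt w : ℤ) : ℚ_[p]) * ã + p = 0)
    (hχe : orderOf χ = semistabilityIndex W p) {u : ℕ} (hu : semistabilityIndex W p * u = p - 1)
    (hteich : ∀ a : ZMod p, a ≠ 0 → ‖χ a - ((a.val : ℕ) : ℚ_[p]) ^ u‖ < 1) {c : ℕ}
    (hc : ∀ (m : ℕ) (a : ℤ), ‖((ratPlusSymbol f ((a : ℚ) / (p : ℚ) ^ m) : ℚ) : ℚ_[p])‖ ≤ (p : ℝ) ^ c)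
    {n : ℕ} {κ : DirichletCharacter ℂ_[p] (p ^ (n + 1 + cyclotomicExponent p))} (hκ : κ.IsPrimitive)
    (heven : κ.Even) (hord : ∃ j : ℕ, orderOf κ = p ^ j)
    {κ' : DirichletCharacter ℂ_[p] (p ^ (n + 1 + 1 + cyclotomicExponent p))} (hκ' : κ'.IsPrimitive)
    (heven' : κ'.Even) (hord' : ∃ j : ℕ, orderOf κ' = p ^ j) {k : ℕ}
    (ht : t = 1 ∨ t = semistabilityIndex W p - 1)
    (hk2 : semistabilityIndex W p * k < 2 * Nat.totient (p ^ (n + 1)))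
    (hval : ‖ratTwistedSymbolSum f κ‖ ^ (semistabilityIndex W p * Nat.totient (p ^ (n + 1))) =
      ((p : ℝ) ^ c) ^ (semistabilityIndex W p * Nat.totient (p ^ (n + 1))) *
        ((p : ℝ)⁻¹) ^ (semistabilityIndex W p * k + t * Nat.totient (p ^ (n + 1))))
    (hval' : ‖ratTwistedSymbolSum f κ'‖ ^ (semistabilityIndex W p * Nat.totient (p ^ (n + 1 + 1))) =
      ((p : ℝ) ^ c) ^ (semistabilityIndex W p * Nat.totient (p ^ (n + 1 + 1))) *
        ((p : ℝ)⁻¹) ^ (semistabilityIndex W p * k + t * Nat.totient (p ^ (n + 1 + 1))))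
    {n₁ : ℕ} (hlt : (p : ℝ) ^ c * (p : ℝ) ^ (-(n₁ : ℤ)) < ‖RS 1 n₁‖) :
    (∃ Dh : PAdicHeightData W p, LeadingTermClauses W p Dh) ∧
    ∀ Dh : PAdicHeightData W p, LeadingTermClauses W p Dh →
      SchneiderConjecture Dh ∧ Finite (AddCommGroup.primaryComponent W.sha p) ∧
      ∀ (K : ZpExtension ℚ p) (γ : Field.absoluteGaloisGroup ℚ),
        K.IsCyclotomic → K.IsTopGenerator γ → IsCyclotomicVariable p γ →
        ∀ (D : W.SelmerDualData K γ) (fE : IwasawaAlgebra p), D.charIdeal = Ideal.span {fE} →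
          1 ≤ X1.MuLambda.lam fE ∧ X1.MuLambda.lam fE ≤ k ∧
          ∃ ℓ : ℕ, ℓ ∣ p ^ 2 ∧ (ReductionNonAnomalous W p → ℓ = 1) ∧
            (padicValNat p (Nat.card (AddCommGroup.primaryComponent W.sha p)) : ℤ) +
                (padicRegulator Dh).valuation + padicValNat p W.tamagawaProduct + padicValNat p ℓ ≤
              X1.MuLambda.mu fE + (RS 1 n₁).valuation + c + 1 + 2 * padicValNat p W.torsionOrder ∧
            ((padicValNat p (Nat.card (AddCommGroup.primaryComponent W.sha p)) : ℤ) +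
                (padicRegulator Dh).valuation + padicValNat p W.tamagawaProduct + padicValNat p ℓ =
              X1.MuLambda.mu fE + (RS 1 n₁).valuation + c + 1 + 2 * padicValNat p W.torsionOrder ↔
              X1.MuLambda.lam fE = k) := by
  have hp2 : p ≠ 2 := by omega
  have h3 : 3 ≤ semistabilityIndex W p := three_le_of_mem he
  have h2 : 2 ≤ semistabilityIndex W p := by omega
  have hG : SubGord W p := (subGord_iff_typeG_of_addv W p hp2 hadd).mpr hGord.typeG
  have hT : TameBranchRatDvdAt W p := tameBranchRatDvdAt_of_thmC hC hDel hDelM h5 hcm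
  -- the sign: the forced partner of `(χ^t, ã)` is tower-bounded
  obtain ⟨C₀, hC₀⟩ := towerBounded_forced_pow_of_thm1_of_two_norm_ratTwistedSymbolSum hD h5 hadd he hf F
    hF w hw hã hroot hχe hu hteich hc hκ heven hord hκ' heven' hord' ht hk2 hval hval'
  have hordt : orderOf (χ ^ t) = semistabilityIndex W p := orderOf_pow_eq_of_mem hχe (by omega) ht
  have hne1 : χ ^ t ≠ 1 := by
    intro h
    rw [h, orderOf_one] at hordt
    omega
  have hU0 := sum_ratPlusSymbol_add_div_eq_zero_of_addv W hf hadd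
  -- the branch of the forced partner, with its truncation bound against the Riemann sums
  obtain ⟨B, hB, hint, hRSle⟩ :=
    exists_isTameBranchOf_riemannSum_of_towerBounded_forced hRS hne1 hã hU0 hC₀
  have hbdB : ∀ j : ℕ, ‖PowerSeries.coeff j B‖ ≤ (p : ℝ) ^ c := hint _ hc
  -- `‖[T¹]B − RS 1 n₁‖ < ‖RS 1 n₁‖`: the exact linear coefficient
  have herr : ‖PowerSeries.coeff 1 B - RS 1 n₁‖ < ‖RS 1 n₁‖ := by
    have hle := hRSle _ hc 1 n₁
    rw [Nat.factorial_one, Nat.cast_one, norm_one, div_one] at hle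
    exact hle.trans_lt hlt
  obtain ⟨hne, -, hvaleq⟩ := valuation_eq_of_norm_sub_lt herr
  -- the first top coefficient of `B` at `k`, on either line
  have hkφ : k < Nat.totient (p ^ (n + 1)) := lt_of_mul_lt_two_mul h2 hk2
  have hfirst : ‖PowerSeries.coeff k B‖ = (p : ℝ) ^ c ∧
      ∀ i < k, ‖PowerSeries.coeff i B‖ < (p : ℝ) ^ c := by
    rcases ht with rfl | rfl
    · rw [one_mul] at hval
      have hB' : IsTameBranchOf f p (χ.ringHomComp (algebraMap ℚ_[p] ℂ_[p])) ã B := by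
        rw [pow_one] at hB; exact hB
      exact hB'.firstTop_of_norm_ratTwistedSymbolSum_pow_eq hã hbdB hteich hχe h2 hu hκ heven hord hkφ hval
    · have hB' : IsTameBranchOf f p (χ⁻¹.ringHomComp (algebraMap ℚ_[p] ℂ_[p])) ã B := by
        rw [pow_sub_one_eq_inv_of_orderOf hχe (by omega)] at hB; exact hB
      exact hB'.firstTop_of_norm_ratTwistedSymbolSum_pow_eq_inv hã hbdB hteich hχe h2 hu hκ heven hord
        hkφ hval
  have hordε : orderOf ((χ ^ t).ringHomComp (algebraMap ℚ_[p] ℂ_[p])) = tameDefect W p := by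
    rw [orderOf_ringHomComp_padicComplex, hordt, tameDefect_of_not_potMult W p hG.1]
  obtain ⟨hmw, -⟩ := hGZK W (by rw [hr])
  have hr1 : W.mordellWeilRank = 1 := by rw [hmw, hr]
  refine ⟨Delbourgo2002.mainTheorem.exists_leadingTermClauses hDel h5 hcm hadd hGord, fun Dh hBcl ↦ ?_⟩
  have hmain : ∀ (K : ZpExtension ℚ p) (γ : Field.absoluteGaloisGroup ℚ),
      K.IsCyclotomic → K.IsTopGenerator γ → IsCyclotomicVariable p γ →
      ∀ (D : W.SelmerDualData K γ) (fE : IwasawaAlgebra p), D.charIdeal = Ideal.span {fE} →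
        SchneiderConjecture Dh ∧ Finite (AddCommGroup.primaryComponent W.sha p) ∧
        1 ≤ X1.MuLambda.lam fE ∧ X1.MuLambda.lam fE ≤ k ∧
        ∃ ℓ : ℕ, ℓ ∣ p ^ 2 ∧ (ReductionNonAnomalous W p → ℓ = 1) ∧
          (padicValNat p (Nat.card (AddCommGroup.primaryComponent W.sha p)) : ℤ) +
              (padicRegulator Dh).valuation + padicValNat p W.tamagawaProduct + padicValNat p ℓ ≤
            X1.MuLambda.mu fE + (RS 1 n₁).valuation + c + 1 + 2 * padicValNat p W.torsionOrder ∧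
          ((padicValNat p (Nat.card (AddCommGroup.primaryComponent W.sha p)) : ℤ) +
              (padicRegulator Dh).valuation + padicValNat p W.tamagawaProduct + padicValNat p ℓ =
            X1.MuLambda.mu fE + (RS 1 n₁).valuation + c + 1 + 2 * padicValNat p W.torsionOrder ↔
            X1.MuLambda.lam fE = k) := by
    intro K γ hK hγ hcv D fE hchar
    haveI : Module.Finite (IwasawaAlgebra p) D.X := D.module_finite_holds hγ
    have h := schneider_and_padicVal_le_rankOne_of_tameBranchRatDvdAt_of_firstTop hT hp2 hadd
      (Or.inr hGord) hf hordε hã hB hbdB hfirst.1 hfirst.2 hne hr1 hBcl hK hγ hcv D hchar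
    rw [hvaleq] at h
    exact h
  obtain ⟨K₀, hK₀, γ₀, hγ₀, hγ₀'⟩ := exists_isCyclotomic_isTopGenerator_isCyclotomicVariable_holds p
  obtain ⟨D₀⟩ := W.nonempty_selmerDualData_holds K₀ γ₀ hγ₀
  haveI : Module.Finite (IwasawaAlgebra p) D₀.X := D₀.module_finite_holds hγ₀
  haveI : (Module.charIdeal (IwasawaAlgebra p) D₀.X).IsPrincipal := charIdeal_isPrincipal_holds p D₀.X
  obtain ⟨fE₀, hchar₀⟩ := Submodule.IsPrincipal.principal (Module.charIdeal (IwasawaAlgebra p) D₀.X)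
  obtain ⟨hS, hfin, -⟩ := hmain K₀ γ₀ hK₀ hγ₀ hγ₀' D₀ fE₀ hchar₀
  exact ⟨hS, hfin, fun K γ hK hγ hcv D fE hchar ↦ (hmain K γ hK hγ hcv D fE hchar).2.2⟩

end Join

/-! ### §5 Class forms: X4♯(G-ord) (`c = 0` by Drinfeld–Manin) and X3♯(G-ord) (bound `p^c`) -/

section Classes

variable {W : WeierstrassCurve ℚ} [W.IsElliptic] [W.IsGloballyMinimal] {p : ℕ} [hp : Fact p.Prime]
  {N : ℕ} [NeZero N] {f : CuspForm (Gamma0 N) 2} {χ : MulChar (ZMod p) ℚ_[p]} {ã : ℚ_[p]} {t : ℕ}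
  {RS : ℕ → ℕ → ℚ_[p]}
  (hRS : ∀ k n : ℕ, RS k n =
      ∑ᶠ ξ : rootsOfUnity (Literature.NumberTheory.EllipticCurves.torsionOrder p) ℤ_[p],
        ∑ s : ZMod (p ^ n),
        twistPartnerMeasure (χ ^ t)
            (TwistPartner.forced (χ ^ t) (fun r ↦ ((ratPlusSymbol f r : ℚ) : ℚ_[p])) ã) ã
            ((ratPlusSymbol f 0 : ℚ) : ℚ_[p]) (n + cyclotomicExponent p)
            (PadicInt.toZModPow (n + cyclotomicExponent p) ((ξ : ℤ_[p]ˣ) : ℤ_[p]) *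
              (cyclotomicGenerator p : ZMod (p ^ (n + cyclotomicExponent p))) ^ s.val) *
          ((s.val.choose k : ℕ) : ℚ_[p]))

include hRS

/-- **X4♯(G-ord), defect 3, 4, 6, `ord_{s=1}L(E,s) = 1`, ANY `λ_an = k`, `p ≥ 5`, non-CM — THE
LEADING-TERM INEQUALITY WITH THE EXTRA ZEROS' CONTRIBUTION FROM PRINT, TWO VALUES AND ONE RIEMANN SUM**
(Drinfeld–Manin `c = 0`): (G)-field / unit root `ã`, `χ = ω^u`, TWO values
`‖S(κ)‖^{eφₙ} = p^{−(ek+tφₙ)}`, `‖S(κ')‖^{eφₙ₊₁} = p^{−(ek+tφₙ₊₁)}` (`t ∈ {1, e−1}`, `e·k < 2φₙ`) and ONE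
Riemann sum of the forced partner of `(χ^t, ã)` with `p^{−n₁} < ‖RS 1 n₁‖_p` ⟹ for every (B)-datum:
Schneider, `#Ш[p^∞] < ∞`, and for every cyclotomic dual datum with generator `fE`: `1 ≤ λ(fE) ≤ k` and
**`ord_p #Ш[p^∞] + ord_p Reg_p + ord_p ∏c + ord_p ℓ ≤ μ(fE) + ord_p RS(1,n₁) + 1 + 2 ord_p #tors`, `=` iff
`λ(fE) = k`**. The `λ_an ≥ 2` window rows on X4 (10878bk1, 11760bb1 @7; EVIDENCE, not an input:
`ord_7 [T¹]B = 1` from gen 23/24's E-FORCED Riemann sums) carry the inequality with extra term `1`.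
Nothing booked; X4♯(G-ord) stays CONSTRUCTION-SHAPED. [cite: Delbourgo1998, Theorem 1 (p. 131)]
[cite: Delbourgo2002, Theorem (A), (B), (C) (p. 40)] [cite: Manin1972, Cor. 3.6] [cite: SteinWuthrich2013, §3]
[cite: Washington1997, §7.1] -/
theorem ClassX4Gord.exists_schneider_and_padicVal_le_rankOne_of_thm1_of_two_norm_ratTwistedSymbolSum_of_riemannSum
    (hD : Delbourgo1998.thm1_exists_bounded_evenMeasure)
    (hC : Delbourgo2002.thmC_charIdeal_dvd_tameBranch) (hDel : Delbourgo2002.mainTheorem)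
    (hDelM : Delbourgo2002.mainTheorem_potMult) (hGZK : rank_eq_analyticRank_of_analyticRank_le_one)
    (hX : ClassX4Gord W p) (h5 : 5 ≤ p) (hcm : ¬ W.HasCM)
    (he : semistabilityIndex W p ∈ ({3, 4, 6} : Finset ℕ)) (hr : W.analyticRank = 1)
    (hf : IsNewformOf W f)
    {L : Type} [Field L] [NumberField L] [IsCyclotomicExtension {p} ℚ L] (F : IntermediateField ℚ L)
    (hF : ∀ w : HeightOneSpectrum (𝓞 F), (p : 𝓞 F) ∈ w.asIdeal →
      (W.baseChange F).HasGoodReductionAt w ∧ (W.baseChange F).HasUnitRootAt w)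
    (w : HeightOneSpectrum (𝓞 F)) (hw : (p : 𝓞 F) ∈ w.asIdeal)
    (hã : ‖ã‖ = 1) (hroot : ã ^ 2 - (((W.baseChange F).frobeniusTraceAt w : ℤ) : ℚ_[p]) * ã + p = 0)
    (hχe : orderOf χ = semistabilityIndex W p) {u : ℕ} (hu : semistabilityIndex W p * u = p - 1)
    (hteich : ∀ a : ZMod p, a ≠ 0 → ‖χ a - ((a.val : ℕ) : ℚ_[p]) ^ u‖ < 1)
    {n : ℕ} {κ : DirichletCharacter ℂ_[p] (p ^ (n + 1 + cyclotomicExponent p))} (hκ : κ.IsPrimitive)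
    (heven : κ.Even) (hord : ∃ j : ℕ, orderOf κ = p ^ j)
    {κ' : DirichletCharacter ℂ_[p] (p ^ (n + 1 + 1 + cyclotomicExponent p))} (hκ' : κ'.IsPrimitive)
    (heven' : κ'.Even) (hord' : ∃ j : ℕ, orderOf κ' = p ^ j) {k : ℕ}
    (ht : t = 1 ∨ t = semistabilityIndex W p - 1)
    (hk2 : semistabilityIndex W p * k < 2 * Nat.totient (p ^ (n + 1)))
    (hval : ‖ratTwistedSymbolSum f κ‖ ^ (semistabilityIndex W p * Nat.totient (p ^ (n + 1))) =
      ((p : ℝ)⁻¹) ^ (semistabilityIndex W p * k + t * Nat.totient (p ^ (n + 1))))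
    (hval' : ‖ratTwistedSymbolSum f κ'‖ ^ (semistabilityIndex W p * Nat.totient (p ^ (n + 1 + 1))) =
      ((p : ℝ)⁻¹) ^ (semistabilityIndex W p * k + t * Nat.totient (p ^ (n + 1 + 1))))
    {n₁ : ℕ} (hlt : (p : ℝ) ^ (-(n₁ : ℤ)) < ‖RS 1 n₁‖) :
    (∃ Dh : PAdicHeightData W p, LeadingTermClauses W p Dh) ∧
    ∀ Dh : PAdicHeightData W p, LeadingTermClauses W p Dh →
      SchneiderConjecture Dh ∧ Finite (AddCommGroup.primaryComponent W.sha p) ∧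
      ∀ (K : ZpExtension ℚ p) (γ : Field.absoluteGaloisGroup ℚ),
        K.IsCyclotomic → K.IsTopGenerator γ → IsCyclotomicVariable p γ →
        ∀ (D : W.SelmerDualData K γ) (fE : IwasawaAlgebra p), D.charIdeal = Ideal.span {fE} →
          1 ≤ X1.MuLambda.lam fE ∧ X1.MuLambda.lam fE ≤ k ∧
          ∃ ℓ : ℕ, ℓ ∣ p ^ 2 ∧ (ReductionNonAnomalous W p → ℓ = 1) ∧
            (padicValNat p (Nat.card (AddCommGroup.primaryComponent W.sha p)) : ℤ) +
                (padicRegulator Dh).valuation + padicValNat p W.tamagawaProduct + padicValNat p ℓ ≤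
              X1.MuLambda.mu fE + (RS 1 n₁).valuation + 1 + 2 * padicValNat p W.torsionOrder ∧
            ((padicValNat p (Nat.card (AddCommGroup.primaryComponent W.sha p)) : ℤ) +
                (padicRegulator Dh).valuation + padicValNat p W.tamagawaProduct + padicValNat p ℓ =
              X1.MuLambda.mu fE + (RS 1 n₁).valuation + 1 + 2 * padicValNat p W.torsionOrder ↔
              X1.MuLambda.lam fE = k) := by
  have hc : ∀ (m : ℕ) (a : ℤ),
      ‖((ratPlusSymbol f ((a : ℚ) / (p : ℚ) ^ m) : ℚ) : ℚ_[p])‖ ≤ (p : ℝ) ^ (0 : ℕ) := fun m a ↦ by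
    rw [pow_zero]
    exact plusSymbolsPIntegralAt_of_classX4 W p hX.1 f hf _
  have h :=
    TwistPartner.exists_schneider_and_padicVal_le_rankOne_of_thm1_of_two_norm_ratTwistedSymbolSum_of_riemannSum
    hRS hD hC hDel hDelM hGZK h5 hcm hX.addv.2 hX.typeGOrd he hr hf F hF w hw hã hroot hχe hu hteich hc hκ
    heven hord hκ' heven' hord' ht hk2 (by rw [pow_zero, one_pow, one_mul]; exact hval)
    (by rw [pow_zero, one_pow, one_mul]; exact hval') (by rw [pow_zero, one_mul]; exact hlt)
  simp only [Nat.cast_zero, add_zero] at h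
  exact h

/-- **X3♯(G-ord) (reducible `E[p]`), defect 3, 4, 6, `ord_{s=1}L(E,s) = 1`, ANY `λ_an = k`, `p ≥ 5` —
the same with the tower bound `p^c` of the plus symbols carried** (`c ≥ 1` only on rational
`p`-isogeny rows where `PlusSymbolsPIntegralAt` fails; measured `c = 0` on every engine row):
**`… ≤ μ(fE) + ord_p RS(1,n₁) + c + 1 + 2 ord_p #tors`, `=` iff `λ(fE) = k`**. The `λ_an ≥ 2` window rows
on X3 (175a1, 6650bi1, 19950dh1 @5: `λ_an = 3, 5, 5`; EVIDENCE: `ord_5 [T¹]B = 1, 1, 2`) carry it.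
Nothing booked; X3♯(G-ord) stays CONSTRUCTION-SHAPED. [cite: Delbourgo1998, Theorem 1 (p. 131)]
[cite: Delbourgo2002, Theorem (A), (B), (C) (p. 40)] [cite: SteinWuthrich2013, §3] [cite: Washington1997, §7.1] -/
theorem ClassX3Gord.exists_schneider_and_padicVal_le_rankOne_of_thm1_of_two_norm_ratTwistedSymbolSum_of_riemannSum
    (hD : Delbourgo1998.thm1_exists_bounded_evenMeasure)
    (hC : Delbourgo2002.thmC_charIdeal_dvd_tameBranch) (hDel : Delbourgo2002.mainTheorem)
    (hDelM : Delbourgo2002.mainTheorem_potMult) (hGZK : rank_eq_analyticRank_of_analyticRank_le_one)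
    (hX : ClassX3Gord W p) (h5 : 5 ≤ p) (hcm : ¬ W.HasCM)
    (he : semistabilityIndex W p ∈ ({3, 4, 6} : Finset ℕ)) (hr : W.analyticRank = 1)
    (hf : IsNewformOf W f)
    {L : Type} [Field L] [NumberField L] [IsCyclotomicExtension {p} ℚ L] (F : IntermediateField ℚ L)
    (hF : ∀ w : HeightOneSpectrum (𝓞 F), (p : 𝓞 F) ∈ w.asIdeal →
      (W.baseChange F).HasGoodReductionAt w ∧ (W.baseChange F).HasUnitRootAt w)
    (w : HeightOneSpectrum (𝓞 F)) (hw : (p : 𝓞 F) ∈ w.asIdeal)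
    (hã : ‖ã‖ = 1) (hroot : ã ^ 2 - (((W.baseChange F).frobeniusTraceAt w : ℤ) : ℚ_[p]) * ã + p = 0)
    (hχe : orderOf χ = semistabilityIndex W p) {u : ℕ} (hu : semistabilityIndex W p * u = p - 1)
    (hteich : ∀ a : ZMod p, a ≠ 0 → ‖χ a - ((a.val : ℕ) : ℚ_[p]) ^ u‖ < 1) {c : ℕ}
    (hc : ∀ (m : ℕ) (a : ℤ), ‖((ratPlusSymbol f ((a : ℚ) / (p : ℚ) ^ m) : ℚ) : ℚ_[p])‖ ≤ (p : ℝ) ^ c)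
    {n : ℕ} {κ : DirichletCharacter ℂ_[p] (p ^ (n + 1 + cyclotomicExponent p))} (hκ : κ.IsPrimitive)
    (heven : κ.Even) (hord : ∃ j : ℕ, orderOf κ = p ^ j)
    {κ' : DirichletCharacter ℂ_[p] (p ^ (n + 1 + 1 + cyclotomicExponent p))} (hκ' : κ'.IsPrimitive)
    (heven' : κ'.Even) (hord' : ∃ j : ℕ, orderOf κ' = p ^ j) {k : ℕ}
    (ht : t = 1 ∨ t = semistabilityIndex W p - 1)
    (hk2 : semistabilityIndex W p * k < 2 * Nat.totient (p ^ (n + 1)))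
    (hval : ‖ratTwistedSymbolSum f κ‖ ^ (semistabilityIndex W p * Nat.totient (p ^ (n + 1))) =
      ((p : ℝ) ^ c) ^ (semistabilityIndex W p * Nat.totient (p ^ (n + 1))) *
        ((p : ℝ)⁻¹) ^ (semistabilityIndex W p * k + t * Nat.totient (p ^ (n + 1))))
    (hval' : ‖ratTwistedSymbolSum f κ'‖ ^ (semistabilityIndex W p * Nat.totient (p ^ (n + 1 + 1))) =
      ((p : ℝ) ^ c) ^ (semistabilityIndex W p * Nat.totient (p ^ (n + 1 + 1))) *
        ((p : ℝ)⁻¹) ^ (semistabilityIndex W p * k + t * Nat.totient (p ^ (n + 1 + 1))))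
    {n₁ : ℕ} (hlt : (p : ℝ) ^ c * (p : ℝ) ^ (-(n₁ : ℤ)) < ‖RS 1 n₁‖) :
    (∃ Dh : PAdicHeightData W p, LeadingTermClauses W p Dh) ∧
    ∀ Dh : PAdicHeightData W p, LeadingTermClauses W p Dh →
      SchneiderConjecture Dh ∧ Finite (AddCommGroup.primaryComponent W.sha p) ∧
      ∀ (K : ZpExtension ℚ p) (γ : Field.absoluteGaloisGroup ℚ),
        K.IsCyclotomic → K.IsTopGenerator γ → IsCyclotomicVariable p γ →
        ∀ (D : W.SelmerDualData K γ) (fE : IwasawaAlgebra p), D.charIdeal = Ideal.span {fE} →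
          1 ≤ X1.MuLambda.lam fE ∧ X1.MuLambda.lam fE ≤ k ∧
          ∃ ℓ : ℕ, ℓ ∣ p ^ 2 ∧ (ReductionNonAnomalous W p → ℓ = 1) ∧
            (padicValNat p (Nat.card (AddCommGroup.primaryComponent W.sha p)) : ℤ) +
                (padicRegulator Dh).valuation + padicValNat p W.tamagawaProduct + padicValNat p ℓ ≤
              X1.MuLambda.mu fE + (RS 1 n₁).valuation + c + 1 + 2 * padicValNat p W.torsionOrder ∧
            ((padicValNat p (Nat.card (AddCommGroup.primaryComponent W.sha p)) : ℤ) +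
                (padicRegulator Dh).valuation + padicValNat p W.tamagawaProduct + padicValNat p ℓ =
              X1.MuLambda.mu fE + (RS 1 n₁).valuation + c + 1 + 2 * padicValNat p W.torsionOrder ↔
              X1.MuLambda.lam fE = k) :=
  TwistPartner.exists_schneider_and_padicVal_le_rankOne_of_thm1_of_two_norm_ratTwistedSymbolSum_of_riemannSum
    hRS hD hC hDel hDelM hGZK h5 hcm hX.addv hX.typeGOrd he hr hf F hF w hw hã hroot hχe hu hteich hc hκ
    heven hord hκ' heven' hord' ht hk2 hval hval' hlt

end Classes

end TwistPartner

end Summit.BirchSwinnertonDyer.Rank1Residual.Additive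

end
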